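import Summits.RiemannHypothesis.RiemannHypothesis.Theorems.TiltedLandingLaw421TwoSidedHeredity

/-! # TiltedLandingLaw421TwoSidedSocket
c14 TWO-SIDED EXIT-LAW socket §Y (C1 rh-idea-5 g20; director (CA241)(K), C4 K-arithmetic l.5218): `LevelClass`, `Budget`, `budgetConst`, `budgetB`, `FootClass`, `InitSharpG` (β-sharpened INIT; `initSharpG_zero_iff`), `ExitLawG` (E⁺ outside a named class 𝓔; `exitLawG_bot_iff`), `UnitBudgetG` (E⁻, netting confined to 𝓔), kernel glue `prefixG_of_twoSided`, literals `InitSharp`/`ExitLaw`/`UnitBudget`, `denseLevelCensusStopLow_of_twoSided` (= (K): INIT ∧ E⁺ ∧ E⁻ ⇒ β-low, for every 𝓔, β, P), `descentSigS'_of_twoSided`.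
SUPPORT module for crux `TiltedLandingLaw421` (stmt-RiemannHypothesis-24774), `--supports` only: proves no stub, no crux; fully proved (no `sorry`).
Packaged by C4 rh-idea-6 g21 per director (CA239)(1) in the (CA237) lint shape. RH is not proved. -/

namespace RhW07.C14.TwoSided

open Complex
open RhIdea6.G17.W07C7 RhIdea6.G17.W07C7.Rev6 RhIdea6.G18.W07C8.Law421BirthS RhIdea6.G19.W07C11.Seam
open RhIdea6.G20.W07C12.Frac RhIdea6.G20.W07C12.StColP RhW07.C12.FieldSplit

/-- a NAMED EXCEPTION CLASS: (datum, level) ↦ Prop — the levels where the per-level exit law is not claimed. -/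
abbrev LevelClass : Type := ℝ → (ℂ → ℂ) → ℝ → ℝ → ℝ → ℝ → ℝ → ℕ → ℕ → Prop

/-- an EXPLICIT BUDGET: a function of the datum `(η, f, x₀, s, hmax, R, Hs, B)` only — never of exits or of the run. -/
abbrev Budget : Type := ℝ → (ℂ → ℂ) → ℝ → ℝ → ℝ → ℝ → ℝ → ℕ → ℝ

/-- candidate budget: a constant `b`. -/
def budgetConst (b : ℝ) : Budget := fun _ _ _ _ _ _ _ _ => b

/-- candidate budget: the column budget `B` of the datum ((CA241) candidate; C4 l.5218: dead through (K) on INIT-tight frames). -/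
def budgetB : Budget := fun _ _ _ _ _ _ _ B => (B : ℝ)

/-- C6's FOOT class (ADD-26): level `j` is FOOT iff the lowest tracked state at level `j+1` has height `< θ·s`. -/
def FootClass (θ : ℝ) (St : StatePred) : LevelClass := fun η f x₀ s hmax R Hs B j =>
  ∃ u' : ℂ, IsLowest St η f x₀ s hmax R Hs B (j + 1) u' ∧ u'.im < θ * s

/-- **β-SHARPENED INIT** (C4 l.5218): the meter at level 0 PLUS the budget fits in the purse. β = 0 is the landed `MonovariantInitG`. -/
def InitSharpG (cE : ℝ) (β : Budget) (M : LevelMeter) : Prop :=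
  ∀ (η : ℝ) (f : ℂ → ℂ) (x₀ s hmax R Hs : ℝ) (B : ℕ), EngineHyps5 2 η f x₀ s hmax R Hs B →
    M η f x₀ s hmax R Hs B 0 + β η f x₀ s hmax R Hs B ≤ (Hs / s) ^ 2 + B + cE

/-- **(E⁺) EXIT LAW outside the named class 𝓔** (netted per level): `M ≥ 0`; no rise at levels outside 𝓔; unit-plus-lift drop with
successors inside the lift at every CHARGED level outside 𝓔.  Research content lives in the instances (tent meters + §X guards). -/
def ExitLawG (μ : ℝ) (P St Ready : StatePred) (𝓔 : LevelClass) (M : LevelMeter) : Prop :=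
  ∀ (η : ℝ) (f : ℂ → ℂ) (x₀ s hmax R Hs : ℝ) (B : ℕ), EngineHyps5 2 η f x₀ s hmax R Hs B →
    (∀ j : ℕ, 0 ≤ M η f x₀ s hmax R Hs B j) ∧
    (∀ j : ℕ, ¬ 𝓔 η f x₀ s hmax R Hs B j → M η f x₀ s hmax R Hs B (j + 1) ≤ M η f x₀ s hmax R Hs B j) ∧
    ∀ j : ℕ, ¬ 𝓔 η f x₀ s hmax R Hs B j → Charged P St Ready η f x₀ s hmax R Hs B j →
      ∃ lam : ℝ, 0 ≤ lam ∧
        (∀ u : ℂ, St η f x₀ s hmax R Hs B j u → ¬ Ready η f x₀ s hmax R Hs B j u →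
          ∃ u' : ℂ, St η f x₀ s hmax R Hs B (j + 1) u' ∧ |u'.im| ≤ |u.im| + lam) ∧
        M η f x₀ s hmax R Hs B (j + 1) + 1 + lam / (μ * s) ≤ M η f x₀ s hmax R Hs B j

open Classical in
/-- **(E⁻) UNIT BUDGET on the named class 𝓔** (netting confined to 𝓔, C4 (iii)): lifts `lam ≥ 0` with successors inside the lift at the charged
levels of 𝓔, and for every `k` the POSITIVE PARTS of the per-level deficits over `j < k, j ∈ 𝓔` fit in the explicit budget `β(datum)`. -/
def UnitBudgetG (μ : ℝ) (P St Ready : StatePred) (𝓔 : LevelClass) (β : Budget) (M : LevelMeter) : Prop :=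
  ∀ (η : ℝ) (f : ℂ → ℂ) (x₀ s hmax R Hs : ℝ) (B : ℕ), EngineHyps5 2 η f x₀ s hmax R Hs B →
    ∃ lam : ℕ → ℝ, (∀ j : ℕ, 0 ≤ lam j) ∧
      (∀ j : ℕ, 𝓔 η f x₀ s hmax R Hs B j → Charged P St Ready η f x₀ s hmax R Hs B j →
        ∀ u : ℂ, St η f x₀ s hmax R Hs B j u → ¬ Ready η f x₀ s hmax R Hs B j u →
          ∃ u' : ℂ, St η f x₀ s hmax R Hs B (j + 1) u' ∧ |u'.im| ≤ |u.im| + lam j) ∧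
      ∀ k : ℕ, (∑ j ∈ Finset.range k,
          (if 𝓔 η f x₀ s hmax R Hs B j then
            max (M η f x₀ s hmax R Hs B (j + 1) - M η f x₀ s hmax R Hs B j
                  + (if Charged P St Ready η f x₀ s hmax R Hs B j then 1 + lam j / (μ * s) else 0)) 0
           else 0)) ≤ β η f x₀ s hmax R Hs B

open Classical in
/-- ★ **(K) TWO-SIDED ⇒ PREFIX** (kernel, telescoping): β-sharpened INIT ∧ exit law outside 𝓔 ∧ unit budget on 𝓔 ⇒ the prefix socket (β1″). -/
theorem prefixG_of_twoSided {μ cE : ℝ} {P St Ready : StatePred} {𝓔 : LevelClass} {β : Budget} {M : LevelMeter}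
    (hI : InitSharpG cE β M) (hX : ExitLawG μ P St Ready 𝓔 M) (hU : UnitBudgetG μ P St Ready 𝓔 β M) :
    MonovariantPrefixG μ cE P St Ready M := by
  intro η f x₀ s hmax R Hs B hE
  classical
  obtain ⟨hM0, hmono, hstep⟩ := hX η f x₀ s hmax R Hs B hE
  obtain ⟨lamU, hlamU0, hsuccU, hbud⟩ := hU η f x₀ s hmax R Hs B hE
  have hinit := hI η f x₀ s hmax R Hs B hE
  -- the combined lift: the unit-budget lift on 𝓔, the exit-law witness at charged levels outside 𝓔, else 0
  let lam : ℕ → ℝ := fun j =>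
    if he : 𝓔 η f x₀ s hmax R Hs B j then lamU j
    else (if hc : Charged P St Ready η f x₀ s hmax R Hs B j then Classical.choose (hstep j he hc) else 0)
  have hlam_in : ∀ j, 𝓔 η f x₀ s hmax R Hs B j → lam j = lamU j := fun j he => by simp only [lam, dif_pos he]
  have hlam_out : ∀ j (he : ¬ 𝓔 η f x₀ s hmax R Hs B j) (hc : Charged P St Ready η f x₀ s hmax R Hs B j),
      lam j = Classical.choose (hstep j he hc) := fun j he hc => by simp only [lam, dif_neg he, dif_pos hc]
  have hlam_zero : ∀ j, ¬ 𝓔 η f x₀ s hmax R Hs B j → ¬ Charged P St Ready η f x₀ s hmax R Hs B j → lam j = 0 :=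
    fun j he hc => by simp only [lam, dif_neg he, dif_neg hc]
  have hlam0 : ∀ j, 0 ≤ lam j := by
    intro j
    by_cases he : 𝓔 η f x₀ s hmax R Hs B j
    · rw [hlam_in j he]; exact hlamU0 j
    · by_cases hc : Charged P St Ready η f x₀ s hmax R Hs B j
      · rw [hlam_out j he hc]; exact (Classical.choose_spec (hstep j he hc)).1
      · rw [hlam_zero j he hc]
  -- per-level cost, and per-level unit (positive part of the deficit) on 𝓔
  let cost : ℕ → ℝ := fun j => if Charged P St Ready η f x₀ s hmax R Hs B j then 1 + lam j / (μ * s) else 0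
  let unit : ℕ → ℝ := fun j =>
    if 𝓔 η f x₀ s hmax R Hs B j then max (M η f x₀ s hmax R Hs B (j + 1) - M η f x₀ s hmax R Hs B j + cost j) 0 else 0
  -- the unit sum IS the budgeted sum (same lifts on 𝓔)
  have hunit_eq : ∀ k : ℕ, (∑ j ∈ Finset.range k, unit j)
      = ∑ j ∈ Finset.range k, (if 𝓔 η f x₀ s hmax R Hs B j then
            max (M η f x₀ s hmax R Hs B (j + 1) - M η f x₀ s hmax R Hs B j
                  + (if Charged P St Ready η f x₀ s hmax R Hs B j then 1 + lamU j / (μ * s) else 0)) 0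
           else 0) := by
    intro k
    refine Finset.sum_congr rfl fun j _ => ?_
    by_cases he : 𝓔 η f x₀ s hmax R Hs B j
    · have hl := hlam_in j he
      simp only [unit, cost, if_pos he, hl]
    · simp only [unit, if_neg he]
  -- the cost sum IS the prefix socket's charge sum
  have hcost_eq : ∀ k : ℕ, (∑ j ∈ Finset.range k, cost j)
      = ∑ j ∈ Finset.range k, (if Charged P St Ready η f x₀ s hmax R Hs B j then 1 + lam j / (μ * s) else 0) :=
    fun k => Finset.sum_congr rfl fun j _ => rfl
  -- telescoping with exceptions: charges below k + meter at k ≤ meter at 0 + units below k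
  have key : ∀ k : ℕ, (∑ j ∈ Finset.range k, cost j) + M η f x₀ s hmax R Hs B k
      ≤ M η f x₀ s hmax R Hs B 0 + ∑ j ∈ Finset.range k, unit j := by
    intro k
    induction k with
    | zero => simp
    | succ k ih =>
      rw [Finset.sum_range_succ, Finset.sum_range_succ]
      by_cases he : 𝓔 η f x₀ s hmax R Hs B k
      · -- exception level: the unit covers the deficit
        have hu : M η f x₀ s hmax R Hs B (k + 1) - M η f x₀ s hmax R Hs B k + cost k ≤ unit k := by
          simp only [unit, if_pos he]; exact le_max_left _ _
        linarith
      · have hu : unit k = 0 := by simp only [unit, if_neg he]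
        by_cases hc : Charged P St Ready η f x₀ s hmax R Hs B k
        · have h3 := (Classical.choose_spec (hstep k he hc)).2.2
          have hcost : cost k = 1 + Classical.choose (hstep k he hc) / (μ * s) := by
            simp only [cost, if_pos hc, hlam_out k he hc]
          rw [hu, hcost]; linarith
        · have hcost : cost k = 0 := by simp only [cost, if_neg hc]
          have h2 := hmono k he
          rw [hu, hcost]; linarith
  refine ⟨lam, hlam0, hM0, ?_, ?_⟩
  · -- successors inside the lift at every charged level
    intro j hc u hu hnr
    by_cases he : 𝓔 η f x₀ s hmax R Hs B j
    · rw [hlam_in j he]; exact hsuccU j he hc u hu hnr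
    · rw [hlam_out j he hc]; exact (Classical.choose_spec (hstep j he hc)).2.1 u hu hnr
  · intro k
    have hb := hbud k
    rw [← hunit_eq k] at hb
    have hk := key k
    rw [hcost_eq k] at hk
    linarith

/-- (c5 witness) the exit law is VACUOUS for 𝓔 = ⊤: any pointwise non-negative meter satisfies it. -/
theorem exitLawG_top {μ : ℝ} {P St Ready : StatePred} {M : LevelMeter}
    (hM : ∀ η f x₀ s hmax R Hs B j, 0 ≤ M η f x₀ s hmax R Hs B j) :
    ExitLawG μ P St Ready (fun _ _ _ _ _ _ _ _ _ => True) M := by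
  intro η f x₀ s hmax R Hs B _
  exact ⟨fun j => hM η f x₀ s hmax R Hs B j, fun j h => (h trivial).elim, fun j h => (h trivial).elim⟩

open Classical in
/-- (c5 witness) the unit budget is VACUOUS for 𝓔 = ⊥ and any non-negative budget: every meter satisfies it. -/
theorem unitBudgetG_bot {μ : ℝ} {P St Ready : StatePred} {β : Budget} {M : LevelMeter}
    (hβ : ∀ η f x₀ s hmax R Hs B, 0 ≤ β η f x₀ s hmax R Hs B) :
    UnitBudgetG μ P St Ready (fun _ _ _ _ _ _ _ _ _ => False) β M := by
  intro η f x₀ s hmax R Hs B _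
  refine ⟨fun _ => 0, fun _ => le_rfl, fun j h => h.elim, fun k => ?_⟩
  simp only [if_false, Finset.sum_const_zero]
  exact hβ η f x₀ s hmax R Hs B

/-- (K, sanity) β = 0: the sharpened INIT is the landed INIT socket. -/
theorem initSharpG_zero_iff {cE : ℝ} {M : LevelMeter} : InitSharpG cE (budgetConst 0) M ↔ MonovariantInitG cE M := by
  constructor
  · intro h η f x₀ s hmax R Hs B hE; have := h η f x₀ s hmax R Hs B hE; simp only [budgetConst, add_zero] at this; exact this
  · intro h η f x₀ s hmax R Hs B hE; have := h η f x₀ s hmax R Hs B hE; simp only [budgetConst, add_zero]; exact this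

/-- (K) with NO exceptions (𝓔 = ⊥) the exit law is exactly the c13 step socket `MonovariantStepG`. -/
theorem exitLawG_bot_iff {μ : ℝ} {P St Ready : StatePred} {M : LevelMeter} :
    ExitLawG μ P St Ready (fun _ _ _ _ _ _ _ _ _ => False) M ↔ MonovariantStepG μ P St Ready M := by
  constructor
  · intro h η f x₀ s hmax R Hs B hE
    obtain ⟨h0, h1, h2⟩ := h η f x₀ s hmax R Hs B hE
    exact ⟨h0, fun j => h1 j not_false, fun j hc => h2 j not_false hc⟩
  · intro h η f x₀ s hmax R Hs B hE
    obtain ⟨h0, h1, h2⟩ := h η f x₀ s hmax R Hs B hE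
    exact ⟨h0, fun j _ => h1 j, fun j _ hc => h2 j hc⟩

/-- β-sharpened INIT at the literals (cE = 1). -/
def InitSharp (β : Budget) (M : LevelMeter) : Prop := InitSharpG 1 β M

/-- (E⁺) at the literals. -/
def ExitLaw (P : StatePred) (𝓔 : LevelClass) (M : LevelMeter) : Prop := ExitLawG (1 / 4) P StCol' (CumReady WindowReady) 𝓔 M

/-- (E⁻) at the literals. -/
def UnitBudget (P : StatePred) (𝓔 : LevelClass) (β : Budget) (M : LevelMeter) : Prop :=
  UnitBudgetG (1 / 4) P StCol' (CumReady WindowReady) 𝓔 β M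

/-- ★ (K) at the literals: TWO-SIDED ⇒ PREFIX (β1″). -/
theorem prefix_of_twoSided {P : StatePred} {𝓔 : LevelClass} {β : Budget} {M : LevelMeter}
    (hI : InitSharp β M) (hX : ExitLaw P 𝓔 M) (hU : UnitBudget P 𝓔 β M) : MonovariantPrefix P M :=
  prefixG_of_twoSided hI hX hU

/-- ★★ **(K) (CA241): INIT♯ ∧ E⁺ ∧ E⁻ ⇒ (β-low)** — `DenseLevelCensusStopLow P` for ANY exception class 𝓔 and explicit budget β, through
M4's `denseLevelCensusStopLow_of_prefix`.  At `P := PSealC4` the conclusion is the registered `stub_denseLevelCensusStopLow`'s statement. -/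
theorem denseLevelCensusStopLow_of_twoSided {P : StatePred} {𝓔 : LevelClass} {β : Budget} {M : LevelMeter}
    (hI : InitSharp β M) (hX : ExitLaw P 𝓔 M) (hU : UnitBudget P 𝓔 β M) : DenseLevelCensusStopLow P :=
  denseLevelCensusStopLow_of_prefix (prefix_of_twoSided hI hX hU)

/-- (K) … and on to `DescentSigS'` with the registered LOW isolated-pair drop, exactly as the c13 sockets. -/
theorem descentSigS'_of_twoSided {𝓔 : LevelClass} {β : Budget} {M : LevelMeter}
    (hI : InitSharp β M) (hX : ExitLaw PSealC4 𝓔 M) (hU : UnitBudget PSealC4 𝓔 β M)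
    (hα : IsolatedPairDropLow PSealC4) : DescentSigS' :=
  descentSigS'_of_prefix hα (prefix_of_twoSided hI hX hU)

end RhW07.C14.TwoSided
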